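import Literature.MathematicalPhysics.QuantumFieldTheory.Balaban1983to89.B6Prop26LeftFactorKLevelV1
import Literature.MathematicalPhysics.QuantumFieldTheory.Balaban1983to89.B6HolderPairMemberV1

/-!
# `Balaban1983to89.B6Prop26HolderGradKLevelV1` — T. Bałaban, *Propagators and renormalization transformations for lattice gauge theories. II*,
# Commun. Math. Phys. **96** (1984) 223–250 [Balaban1984PropagatorsII], Prop. 2.6 p. 247, THE HÖLDER ENTRY (2.137)₁ `‖ζ∇GJ‖_α` AT k LEVELS FOR THE
# GENUINE `G = Δ_a⁻¹` ON THE V1 TORUS — THE HÖLDER QUOTIENT AS A PAIR-DIFFERENCE LEFT FACTOR OF THE (2.141)-WALK: (2.137)₁ FROM ITS FIRST LEGS,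
# AND PRINT'S CUT-OFF FORM `(‖ζ‖_α + |ζ|)`

statement-level skeleton of published theorems with citation tags; proofs where landed; nothing here is a claim about the Yang–Mills mass gap

PDF held: `paper:balaban1984-cmp96-propagators-rt-ii` (journal page = PDF page + 222), p. 247 [PDF 25] re-read this generation on the ×2 render
`b2b-balaban-ref1/pages/1984-cmp96-propagators-rt-II/1984-cmp96-propagators-rt-II-p025-x2.png`: *"‖ζ∇GJ‖_α, ‖ζG∇*J‖_α ≤ O(1)(Lʲη)^{1−α}(‖ζ‖^ξ_α + |ζ|)
e^{−δ₃d(y,y′)}|J|, ξ = L^{−j} (2.137) for 0 ≤ α < 1, ζ ∈ C₀^∞(Δ̃(y)) (the cube Δ̃(y) for y ∈ Λ_j is a sum of 2^d unit cubes on the L^{−j}-scale, having y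
as a corner), supp J ⊂ Δ(y′), with the constant O(1) depending on d, L and α (O(1) → ∞ if α → 1)"*; p. 248 [PDF 26]: *"Let us remark that the symbol
‖·‖^ξ_α indicates the scale ξ for which the Hölder norm is taken"*; [4] = *… I*, CMP **95** (1984) (1.109) p. 35 (as quoted in the tree's
`…B6BlockHolderCalculus`): *"‖A‖_α = max_μ sup_{x,x′: |x−x′| ≤ 1} |x − x′|^{−α}|A_μ(x) − A_μ(x′)|"*; p. 247: *"G = … = Σ_ω h_{□₀}G_{□₀}h_{□₀}K_{□₁,□₂}… (2.141)
and the series above is convergent in the norms appearing in the inequalities (2.136)–(2.140)."*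

CITATION HEADER (lean-in-tree rule) — WHAT IS REPRODUCED.  Phase-2 file of the `lit-balaban` typed skeleton (HOME `run/shared/lean/pub/lit-balaban/`),
seat **p22 gen 26** (free target under protocol G.5-34(d), TAKING line HOME/STATUS.md 2026-08-23T22:15Z, cc the B6 fold owner r03 and p38); SKELETON
row **B6.Prop2.6** (cells only; head unchanged, owner r03).  THE READING.  The Hölder quotient of (1.109) at ONE pair of fine bonds `(x, x′)` of the
same direction is the value at `x` of the PAIR-DIFFERENCE OPERATOR `P_{x,x′} := e_x ⊗ (δ_x − δ_{x′})` (`pairOp x x′ := LinearMap.single ℝ _ x ∘ₗ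
(LinearMap.proj x − LinearMap.proj x′)`, this seat's `…B6HolderPairMemberV1`) applied to `∇_νGJ`; `P_{x,x′}·∇_ν` is a LEFT FACTOR of the walk (2.141), so this seat's
`…B6Prop26LeftFactorKLevelV1.prop26_leftFactor_kLevel_unconditional` bounds `P_{x,x′}∇_νG` from its first legs `P_{x,x′}∇_ν(h_□G_□h_□)` — print's *"reasoning in
the same way as in the proof of Proposition 2.2"* for the Hölder column ((2.66) p. 234: *"The similar inequalities hold … for a Hölder norm of a derivative,
but with (Lʲη)² replaced by … (Lʲη)^{1−α}"*).  UNITS (declared reading): with `t := |x − x′|_∞/L^{j(y)} ≤ 1` the relative distance at the scale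
`ξ` of the output block and print's quotient taken in lattice lengths `|x − x′| = (Lʲη)·t`, (2.137)₁ reads
`|(∇_νGJ)(x) − (∇_νGJ)(x′)| ≤ O(1)·(Lʲη)^{1−α}·((Lʲη)t)^α·e^{−δ₃d}|J| = O(1)·(Lʲη)·t^α·e^{−δ₃d(y,y′)}|J|` — the slot-2 prefactor `Lʲη = (geomT D).len y·|c′|⁻¹`
times `t^α`, the only form covariant under the tree's free fine factor `c′` (`G ∝ c′⁻²`); the weight is kept GENERAL (`Pw ≥ 0`) in the theorems below
and the Hölder weight `t^α·(L^{j(y)}·|c′|⁻¹)` is the intended instance.  Contents: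
* (the pair-difference operator `pairOp x x′`, its majorant dictionary `hasMajorant_pairOp_mul` / `pairDiff_le_of_hasMajorant` and the product rule
  `abs_cutoff_pair_le` are this seat's `…B6HolderPairMemberV1` §0, imported BY NAME);
* §2 **`prop26_2137_grad_kLevel_of_legs`** — (2.137)₁ AT k LEVELS FOR THE GENUINE `G` FROM ITS FIRST LEGS: for the weight band and a legs-rate `ρ_H > 0`
  there is `σ₁ > 0` and for all `0 < σ ≤ σ₁`, budget `0 < β ≤ 1`, constants `A ≥ 0`, `M₂ > 0` such that on every admissible V1 torus, for every direction
  `ν`, pair `(x, x′)`, constant `C_H ≥ 0` and weight `Pw ≥ 0`: if every cube's first leg satisfies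
  `HasMajorant (P_{x,x′}·∇_ν·(h_□G_□h_□)) (1_{□̃}(y)·C_H·Pw(y)·e^{−ρ_H d_T})`, then `HasMajorant (P_{x,x′}·∇_ν·onFun G) ((A·C_H)·Pw(y)·e^{−δ₃d_T})` (the
  shape r03's Cor. 2.8 composition `…B6Cor28KLevelV1.comp_entry_le` consumes) and, pointwise, for every `J` supported in the block `y′` with `|J| ≤ B`:
  `|(∇_νGJ)(x) − (∇_νGJ)(x′)| ≤ (A·C_H)·Pw(y(x))·e^{−δ₃d_T(y(x),y′)}·B`, `δ₃ = delta3 β (2σ)`;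
* §3 **`prop26_2137_grad_kLevel_cutoff_of_legs`** — PRINT'S CUT-OFF FORM: the same package delivers, with ONE set of constants, the slot-2 sup bound
  (p38's `…B6Prop26GradKLevelV1.prop26_2136_grad_kLevel_unconditional`, BY NAME) and, for every cut-off `ζ` with `|ζ(x′)| ≤ Z₀`, `|ζ(x) − ζ(x′)| ≤ Z_d`:
  `|ζ(x)(∇_νGJ)(x) − ζ(x′)(∇_νGJ)(x′)| ≤ (Z₀·(A·C_H)·Pw(y(x)) + Z_d·A·(L^{j(y(x))}·|c′|⁻¹))·e^{−δ₃d_T}·B` — with `Pw = t^α·Lʲη` and `Z_d = ‖ζ‖_α·t^α` this is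
  print's `O(1)(Lʲη)t^α(‖ζ‖_α + |ζ|)e^{−δ₃d}|J|` in the units above.
IMPORTS BY NAME, restating nothing; THEOREMS ONLY (no `def`, no `def … : Prop`, no new hypothesis); standard axioms.

HONEST SCOPE / DIVERGENCES.  (1) The per-cube HÖLDER FIRST LEGS stay DISPLAYED here (hypothesis of §2–§3); they are this seat's next file (from p38's
two-scale [4] (1.111) member `…B6Prop25HolderTwoScaleV1.holderBound_DG_scaling` through r03's window transplant, with the mixed second differences of
`h_□`) — until then (2.137)₁ at k levels is proved MODULO its first legs, exactly as p38's `(2.136)₃` bricks were before `hGDVa0_cube`.  (2) One pair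
`(x, x′)` at a time, any two fine bonds (print: same component, `x, x′ ∈ Δ̃(y)`, `|x − x′| ≤ ξ`; the admissibility enters only through the legs and the
weight); the quotient is read in the dimensionless `t` (see UNITS) — print's `(Lʲη)^{1−α}` presumes lattice lengths.  (3) The second member `‖ζG∇*J‖_α` of
(2.137) (a right factor under a left pair difference: a two-sided walk) and (2.138)–(2.139) are NOT treated.  (4) Setting as in the imported files (V1 torus,
`k ≥ 2`, `M_h = Lᵃ ≥ 8`, `R ≥ 2L²`, `P′ ≥ 5`, odd `L ≥ 5`, top cubes placed, weights in the band (2.16)); constants on `d, L, b₀, b₁, σ, β` — print: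
*"O(1) depending on d, L and α"*.  Integer torus, lattice units; nothing on d = 4 specifically or the continuum; NOT summit progress.  Unit `lit-balaban-p22`
(gen 26), 2026-08-23.
-/

open scoped BigOperators
open Finset

namespace Literature.MathematicalPhysics.QuantumFieldTheory.Balaban1983to89.B6Prop26HolderGradKLevelV1

open B4Reflection242 (boxDom)
open B6MultiLevelBoxOperator (N0)
open B6MultiLevelTorusOperator (TDomains)
open B6Cover236MultiLevelBlocks (cubes)
open B6Geom246MultiLevelTorus (geomT)
open B8Ineq192MultiLevelTorus (geomTB geomT_len)
open B6RandomWalk (HasMajorant hasMajorant_mono delta3 BlockSupp)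
open B6Prop26Gluing (mulOp ind ind_nonneg)
open B6Ineq2133TwoScaleV1 (onFun)
open B6GlobalChartV1 (PV domT blkV1)
open B6SectAOperatorsV1 (BondIdx)
open B6SectAVectorModelV1 (GE)
open B6Prop26KLevelSkeletonV1 (hB ST pref)
open B6Prop26KLevelSkeletonV2 (SbigT)
open B6CubeWindowV1 (Placed Gl GlobalBand band_le one_le_of_eight_le four_le_of_five_le)
open B6Prop26KLevelAssemblyV1 (distT_nonneg)
open B6GradLegKLevelV1 (DV)
open B6Prop26GradKLevelV1 (prop26_2136_grad_kLevel_unconditional)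
open B6Prop26LeftFactorKLevelV1 (prop26_leftFactor_kLevel_unconditional)
open B6HolderPairMemberV1 (pairOp pairOp_apply pairOp_mul_apply hasMajorant_pairOp_mul pairDiff_le_of_hasMajorant abs_cutoff_pair_le)

noncomputable section


variable {d ℓ : ℕ} {hd : 1 ≤ d + 1} {hL : Odd (ℓ + 1) ∧ 1 < ℓ + 1} {m K : ℕ} {Mh k R : ℕ} {P' : Fin (d + 1) → ℕ}

/-! ## §2  (2.137)₁ at k levels for the genuine `G` from its first legs -/

section OfLegs

open Classical in
/-- **PROPOSITION 2.6 (2.137)₁ `‖ζ∇GJ‖_α` AT k LEVELS FOR THE GENUINE `G = Δ_a⁻¹`, FROM THE FIRST LEGS OF THE WALK (2.141)** (the cut-off `ζ` is put on in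
§3): for every weight band `[b₀, b₁]` and legs-rate `ρ_H > 0` there is `σ₁ > 0` (`≤ ρ_H`) such that for all `0 < σ ≤ σ₁`, `0 < β ≤ 1` there are `A ≥ 0`,
`M₂ > 0` with: on every V1 global torus with `k ≥ 2`, `M_h = Lᵃ ≥ 8`, `M₂ ≤ L·M_h`, `R ≥ 2L²`, `P′ ≥ 5`, `L ≥ 5`, all cubes placed, `c′ ≠ 0`, weights in the
band, for every direction `ν`, every pair of fine bonds `(x, x′)`, every `C_H ≥ 0` and weight `Pw ≥ 0` (intended: `Pw(y) = t^α·(L^{j(y)}·|c′|⁻¹)`,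
`t = |x − x′|_∞/L^{j(y(x))} ≤ 1`): IF every cube's first leg has `HasMajorant (P_{x,x′}·∇_ν·(h_□G_□h_□)) (1_{□̃}(y)·C_H·Pw(y)·e^{−ρ_H d_T(y,y′)})` (output
indicator of `□̃ = SbigT` — the output block of a cross-block pair near the cube lies in `□̃`, not always in `□⁺`; legs rate `ρ_H ≥ σ`) THEN
`HasMajorant (P_{x,x′}·∇_ν·onFun G) ((A·C_H)·Pw(y)·e^{−δ₃d_T(y,y′)})` and, for every `J` supported in the block `y′` with `|J| ≤ B`:
`|(∇^η_νGJ)(x) − (∇^η_νGJ)(x′)| ≤ (A·C_H)·Pw(y(x))·e^{−δ₃d_T(y(x),y′)}·B`, `δ₃ = delta3 β (2σ)`.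
[cite: Balaban1984PropagatorsII, Prop. 2.6 (2.137) p.247 («‖ζ∇GJ‖_α ≤ O(1)(Lʲη)^{1−α}(‖ζ‖^ξ_α+|ζ|)e^{−δ₃d(y,y′)}|J|»), (2.141) p.247, (2.66) p.234; [4] (1.109) p.35] -/
theorem prop26_2137_grad_kLevel_of_legs (d ℓ : ℕ) (hd : 1 ≤ d + 1) (hL : Odd (ℓ + 1) ∧ 1 < ℓ + 1) {b₀ b₁ : ℝ} (hb₀ : 0 < b₀) (hb₁ : b₀ ≤ b₁)
    {ρH : ℝ} (hρH : 0 < ρH) :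
    ∃ σ₁ : ℝ, 0 < σ₁ ∧ σ₁ ≤ ρH ∧ ∀ (σ : ℝ), 0 < σ → σ ≤ σ₁ → ∀ (β : ℝ), 0 < β → β ≤ 1 →
    ∃ A M₂ : ℝ, 0 ≤ A ∧ 0 < M₂ ∧
    ∀ (m K : ℕ) {Mh k R : ℕ} {P' : Fin (d + 1) → ℕ}
      (hN : ∀ μ, N0 ℓ Mh k P' μ = (PV d ℓ m K hd hL).sitesPerDir 0) (D : TDomains d ℓ Mh k P' R) (hk : k ≤ m + K) (_ : 2 ≤ k)
      {a : ℕ} (hMha : Mh = (ℓ + 1) ^ a) (hM8 : 8 ≤ Mh) (_ : 2 * (ℓ + 1) ^ 2 ≤ R) (hP5 : ∀ μ, 5 ≤ P' μ) (_ : 4 ≤ ℓ)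
      (hpl : ∀ c : ↥(cubes D.toDomains), Placed ℓ k P' c.1) (_ : M₂ ≤ ((ℓ : ℝ) + 1) * Mh)
      {cf : ℝ} (hcf : cf ≠ 0) {w : BondIdx (domT hN D hk) → ℝ} (hw : ∀ i, 0 < w i) (_ : GlobalBand b₀ b₁ cf w)
      (ν : Fin (d + 1)) (x x' : PBond (PV d ℓ m K hd hL) 0) (CH : ℝ) (Pw : (geomT D).Site → ℝ), 0 ≤ CH → (∀ y, 0 ≤ Pw y) →
      (∀ c : ↥(cubes D.toDomains), HasMajorant (g := geomT D) (blkV1 hN D)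
        (pairOp x x' * DV (P := PV d ℓ m K hd hL) ν cf *
          (mulOp (hB hN D c) *
            Gl hN hk (one_le_of_eight_le hM8) (four_le_of_five_le hP5) hMha c (band_le (d := d) (ℓ := ℓ) hb₀ hb₁) (hpl c) w cf *
            mulOp (hB hN D c)))
        (fun y y' => ind (SbigT D (one_le_of_eight_le hM8) (four_le_of_five_le hP5) c) y *
          (CH * Pw y * Real.exp (-(ρH * (geomT D).dist y y'))))) →
      HasMajorant (g := geomT D) (blkV1 hN D) (pairOp x x' * DV (P := PV d ℓ m K hd hL) ν cf * onFun (GE (domT hN D hk) hcf hw))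
          (fun y y' => A * CH * Pw y * Real.exp (-(delta3 β (2 * σ) * (geomT D).dist y y'))) ∧
      ∀ (y' : (geomT D).Site) (μ : PBond (PV d ℓ m K hd hL) 0 → ℝ) (B : ℝ), BlockSupp (blkV1 hN D) μ y' B →
        |(DV (P := PV d ℓ m K hd hL) ν cf * onFun (GE (domT hN D hk) hcf hw)) μ x - (DV (P := PV d ℓ m K hd hL) ν cf * onFun (GE (domT hN D hk) hcf hw)) μ x'| ≤
          A * CH * Pw (blkV1 hN D x) * Real.exp (-(delta3 β (2 * σ) * (geomT D).dist (blkV1 hN D x) y')) * B := by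
  obtain ⟨σ₁, hσ₁, h⟩ := prop26_leftFactor_kLevel_unconditional d ℓ hd hL hb₀ hb₁
  refine ⟨min σ₁ ρH, lt_min hσ₁ hρH, min_le_right _ _, fun σ hσ hσ1 β hβ hβ1 => ?_⟩
  obtain ⟨A, M₂, hA, hM₂, h2⟩ := h σ hσ (hσ1.trans (min_le_left _ _)) β hβ hβ1
  refine ⟨A, M₂, hA, hM₂, ?_⟩
  intro m K Mh k R P' hN D hk hk2 a hMha hM8 hR2 hP5 hℓ hpl hM cf hcf w hw hwb ν x x' CH Pw hCH hPw hlegs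
  have hdnn : ∀ y y' : (geomT D).Site, 0 ≤ (geomT D).dist y y' := distT_nonneg
  have hσρ : σ ≤ ρH := hσ1.trans (min_le_right _ _)
  have hres := (h2 m K hN D hk hk2 hMha hM8 hR2 hP5 hℓ hpl hM hcf hw hwb).2 (pairOp x x' * DV (P := PV d ℓ m K hd hL) ν cf) CH Pw hCH hPw
    fun c => hasMajorant_mono _ (hlegs c) fun y y' =>
      mul_le_mul_of_nonneg_left (mul_le_mul_of_nonneg_left (Real.exp_le_exp.mpr (neg_le_neg (mul_le_mul_of_nonneg_right hσρ (hdnn y y'))))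
        (mul_nonneg hCH (hPw y))) (ind_nonneg _ _)
  refine ⟨hres, fun y' μ B hμ => ?_⟩
  rw [mul_assoc] at hres
  exact pairDiff_le_of_hasMajorant (blkV1 hN D) x x' hres y' μ B hμ

end OfLegs

/-! ## §3  Print's cut-off form: `(‖ζ‖_α + |ζ|)` by the product rule, slot 2 and the pair bound with one set of constants -/

section Cutoff

open Classical in
/-- **PROPOSITION 2.6 (2.137)₁ IN PRINT'S CUT-OFF FORM, AT k LEVELS FOR THE GENUINE `G`, FROM THE FIRST LEGS** — one package of constants for the sup
entry (2.136)₂ (p38's `prop26_2136_grad_kLevel_unconditional`, BY NAME) and the Hölder pair bound of §2: for the weight band and `ρ_H > 0` there is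
`σ₁ > 0` and for all `0 < σ ≤ σ₁`, `0 < β ≤ 1` constants `A ≥ 0`, `M₂ > 0` such that on every admissible V1 torus (binders of §2): (i) for every `ν`,
`HasMajorant (∇_ν∘G) (A·(L^{j(y)}·|c′|⁻¹)·e^{−δ₃d_T})`; (ii) for every `ν`, pair `(x, x′)`, `C_H ≥ 0`, `Pw ≥ 0` with the first legs of §2, every cut-off
`ζ` on the fine bonds with `|ζ(x′)| ≤ Z₀`, `|ζ(x) − ζ(x′)| ≤ Z_d`, and every `J` supported in the block `y′` with `|J| ≤ B`:
`|ζ(x)(∇_νGJ)(x) − ζ(x′)(∇_νGJ)(x′)| ≤ (Z₀·(A·C_H)·Pw(y(x)) + Z_d·A·(L^{j(y(x))}·|c′|⁻¹))·e^{−δ₃d_T(y(x),y′)}·B` — print's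
`O(1)(Lʲη)^{1−α}(‖ζ‖^ξ_α + |ζ|)e^{−δ₃d(y,y′)}|J|` with `Pw = t^α·Lʲη`, `Z_d = ‖ζ‖_α t^α` (UNITS in the header).
[cite: Balaban1984PropagatorsII, Prop. 2.6 (2.136)–(2.137) p.247, (2.141) p.247; [4] (1.109), (1.111) p.35] -/
theorem prop26_2137_grad_kLevel_cutoff_of_legs (d ℓ : ℕ) (hd : 1 ≤ d + 1) (hL : Odd (ℓ + 1) ∧ 1 < ℓ + 1) {b₀ b₁ : ℝ} (hb₀ : 0 < b₀)
    (hb₁ : b₀ ≤ b₁) {ρH : ℝ} (hρH : 0 < ρH) :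
    ∃ σ₁ : ℝ, 0 < σ₁ ∧ σ₁ ≤ ρH ∧ ∀ (σ : ℝ), 0 < σ → σ ≤ σ₁ → ∀ (β : ℝ), 0 < β → β ≤ 1 →
    ∃ A M₂ : ℝ, 0 ≤ A ∧ 0 < M₂ ∧
    ∀ (m K : ℕ) {Mh k R : ℕ} {P' : Fin (d + 1) → ℕ}
      (hN : ∀ μ, N0 ℓ Mh k P' μ = (PV d ℓ m K hd hL).sitesPerDir 0) (D : TDomains d ℓ Mh k P' R) (hk : k ≤ m + K) (_ : 2 ≤ k)
      {a : ℕ} (hMha : Mh = (ℓ + 1) ^ a) (hM8 : 8 ≤ Mh) (_ : 2 * (ℓ + 1) ^ 2 ≤ R) (hP5 : ∀ μ, 5 ≤ P' μ) (_ : 4 ≤ ℓ)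
      (hpl : ∀ c : ↥(cubes D.toDomains), Placed ℓ k P' c.1) (_ : M₂ ≤ ((ℓ : ℝ) + 1) * Mh)
      {cf : ℝ} (hcf : cf ≠ 0) {w : BondIdx (domT hN D hk) → ℝ} (hw : ∀ i, 0 < w i) (_ : GlobalBand b₀ b₁ cf w),
      (∀ ν : Fin (d + 1), HasMajorant (g := geomT D) (blkV1 hN D) (DV (P := PV d ℓ m K hd hL) ν cf ∘ₗ onFun (GE (domT hN D hk) hcf hw))
        (fun y y' => A * ((geomT D).len y * |cf|⁻¹) * Real.exp (-(delta3 β (2 * σ) * (geomT D).dist y y')))) ∧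
      ∀ (ν : Fin (d + 1)) (x x' : PBond (PV d ℓ m K hd hL) 0) (CH : ℝ) (Pw : (geomT D).Site → ℝ), 0 ≤ CH → (∀ y, 0 ≤ Pw y) →
      (∀ c : ↥(cubes D.toDomains), HasMajorant (g := geomT D) (blkV1 hN D)
        (pairOp x x' * DV (P := PV d ℓ m K hd hL) ν cf *
          (mulOp (hB hN D c) *
            Gl hN hk (one_le_of_eight_le hM8) (four_le_of_five_le hP5) hMha c (band_le (d := d) (ℓ := ℓ) hb₀ hb₁) (hpl c) w cf *
            mulOp (hB hN D c)))
        (fun y y' => ind (SbigT D (one_le_of_eight_le hM8) (four_le_of_five_le hP5) c) y *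
          (CH * Pw y * Real.exp (-(ρH * (geomT D).dist y y'))))) →
      ∀ (ζ : PBond (PV d ℓ m K hd hL) 0 → ℝ) (Z₀ Zd : ℝ), |ζ x'| ≤ Z₀ → |ζ x - ζ x'| ≤ Zd →
      ∀ (y' : (geomT D).Site) (μ : PBond (PV d ℓ m K hd hL) 0 → ℝ) (B : ℝ), BlockSupp (blkV1 hN D) μ y' B →
        |ζ x * (DV (P := PV d ℓ m K hd hL) ν cf * onFun (GE (domT hN D hk) hcf hw)) μ x - ζ x' * (DV (P := PV d ℓ m K hd hL) ν cf * onFun (GE (domT hN D hk) hcf hw)) μ x'| ≤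
          (Z₀ * (A * CH * Pw (blkV1 hN D x)) + Zd * (A * ((geomT D).len (blkV1 hN D x) * |cf|⁻¹))) *
            Real.exp (-(delta3 β (2 * σ) * (geomT D).dist (blkV1 hN D x) y')) * B := by
  obtain ⟨σ₁, hσ₁, hσ₁ρ, h⟩ := prop26_2137_grad_kLevel_of_legs d ℓ hd hL hb₀ hb₁ hρH
  obtain ⟨σ₂, hσ₂, h'⟩ := prop26_2136_grad_kLevel_unconditional d ℓ hd hL hb₀ hb₁
  refine ⟨min σ₁ σ₂, lt_min hσ₁ hσ₂, (min_le_left _ _).trans hσ₁ρ, fun σ hσ hσ1 β hβ hβ1 => ?_⟩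
  obtain ⟨A, M₂, hA, hM₂, h2⟩ := h σ hσ (hσ1.trans (min_le_left _ _)) β hβ hβ1
  obtain ⟨A', M₂', hA', hM₂', h2'⟩ := h' σ hσ (hσ1.trans (min_le_right _ _)) β hβ hβ1
  refine ⟨max A A', max M₂ M₂', le_max_of_le_left hA, lt_max_of_lt_left hM₂, ?_⟩
  intro m K Mh k R P' hN D hk hk2 a hMha hM8 hR2 hP5 hℓ hpl hM cf hcf w hw hwb
  have hdnn : ∀ y y' : (geomT D).Site, 0 ≤ (geomT D).dist y y' := distT_nonneg
  have hlen0 : ∀ y : (geomT D).Site, 0 ≤ (geomT D).len y * |cf|⁻¹ := fun y => by rw [geomT_len]; positivity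
  obtain ⟨-, hslot2⟩ := h2' m K hN D hk hk2 hMha hM8 hR2 hP5 hℓ hpl ((le_max_right _ _).trans hM) hcf hw hwb
  refine ⟨fun ν => hasMajorant_mono _ (hslot2 ν) fun y y' => ?_, ?_⟩
  · exact mul_le_mul_of_nonneg_right (mul_le_mul_of_nonneg_right (le_max_right _ _) (hlen0 y)) (Real.exp_nonneg _)
  intro ν x x' CH Pw hCH hPw hlegs ζ Z₀ Zd hZ₀ hZd y' μ B hμ
  -- the pair bound (§2) and the sup bound (slot 2) at the output block of `x`
  have hpair := (h2 m K hN D hk hk2 hMha hM8 hR2 hP5 hℓ hpl ((le_max_left _ _).trans hM) hcf hw hwb ν x x' CH Pw hCH hPw hlegs).2 y' μ B hμ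
  have hsup : |(DV (P := PV d ℓ m K hd hL) ν cf * onFun (GE (domT hN D hk) hcf hw)) μ x| ≤
      A' * ((geomT D).len (blkV1 hN D x) * |cf|⁻¹) * Real.exp (-(delta3 β (2 * σ) * (geomT D).dist (blkV1 hN D x) y')) * B :=
    hslot2 ν y' μ B hμ x
  have hB := hμ.nonneg
  have hE := Real.exp_nonneg (-(delta3 β (2 * σ) * (geomT D).dist (blkV1 hN D x) y'))
  have hP := hPw (blkV1 hN D x)
  have hl := hlen0 (blkV1 hN D x)
  have hZ₀0 : 0 ≤ Z₀ := (abs_nonneg _).trans hZ₀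
  have hZd0 : 0 ≤ Zd := (abs_nonneg _).trans hZd
  calc |ζ x * (DV (P := PV d ℓ m K hd hL) ν cf * onFun (GE (domT hN D hk) hcf hw)) μ x - ζ x' * (DV (P := PV d ℓ m K hd hL) ν cf * onFun (GE (domT hN D hk) hcf hw)) μ x'|
      ≤ |ζ x'| * |(DV (P := PV d ℓ m K hd hL) ν cf * onFun (GE (domT hN D hk) hcf hw)) μ x - (DV (P := PV d ℓ m K hd hL) ν cf * onFun (GE (domT hN D hk) hcf hw)) μ x'| +
          |ζ x - ζ x'| * |(DV (P := PV d ℓ m K hd hL) ν cf * onFun (GE (domT hN D hk) hcf hw)) μ x| :=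
        abs_cutoff_pair_le ζ _ x x'
    _ ≤ Z₀ * (A * CH * Pw (blkV1 hN D x) * Real.exp (-(delta3 β (2 * σ) * (geomT D).dist (blkV1 hN D x) y')) * B) +
          Zd * (A' * ((geomT D).len (blkV1 hN D x) * |cf|⁻¹) * Real.exp (-(delta3 β (2 * σ) * (geomT D).dist (blkV1 hN D x) y')) * B) :=
        add_le_add (mul_le_mul hZ₀ hpair (abs_nonneg _) hZ₀0) (mul_le_mul hZd hsup (abs_nonneg _) hZd0)
    _ ≤ Z₀ * (max A A' * CH * Pw (blkV1 hN D x) * Real.exp (-(delta3 β (2 * σ) * (geomT D).dist (blkV1 hN D x) y')) * B) +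
          Zd * (max A A' * ((geomT D).len (blkV1 hN D x) * |cf|⁻¹) * Real.exp (-(delta3 β (2 * σ) * (geomT D).dist (blkV1 hN D x) y')) * B) := by
        gcongr
        · exact le_max_left _ _
        · exact le_max_right _ _
    _ = (Z₀ * (max A A' * CH * Pw (blkV1 hN D x)) + Zd * (max A A' * ((geomT D).len (blkV1 hN D x) * |cf|⁻¹))) *
          Real.exp (-(delta3 β (2 * σ) * (geomT D).dist (blkV1 hN D x) y')) * B := by ring

end Cutoff

end

end Literature.MathematicalPhysics.QuantumFieldTheory.Balaban1983to89.B6Prop26HolderGradKLevelV1
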